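import Literature.MathematicalPhysics.QuantumFieldTheory.Sweep1ChatterjeeFreeEnergyProofs
import Literature.MathematicalPhysics.QuantumLattice.RepLieAlgebra
import HarnessLib

/-!
# Transfer from the joint cube limit to the torus free energy — crux `FreeEnergyLogCoefficient`, line Sketch, stub `Transfer`

Route `EquipartitionCriticality` of `QuantumFields/YangMills`, crux
`Summit.QuantumFields.YangMills.Theses.EquipartitionCriticality.FreeEnergyLogCoefficient`
(S. Chatterjee, *The leading term of the Yang–Mills free energy*, arXiv:1602.01222, Thm. 2.1 and §17).

The last step of the line: for a lattice representation `r : LatticeRep G` of a compact group `G`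
in `d = 4`, the joint limit (in `n → ∞`, `β → ∞`) of the free-boundary cube free energies
`F(B_n, β) + ½ (3 − 4/n + n^{-4}) D log β → K₀` passes to the torus free energy density
`f_r(β) = freeEnergyDensity 4 r.ρ β` of `LatticeGaugeDLR` with the crux's coefficient
`(3/2) · finrank(span{X | ∀ t, exp(tX) ∈ range r.ρ})`:

* `G` is second countable (`r.ρ` is a closed embedding into `M_N(ℂ)`);
* at fixed `β`, `F(B_n, β) → f_r(β)` (`ChatterjeeFreeEnergy.tendsto_freeEnergyPerSite_halfOpenBox`,
  boundary-condition independence of the free energy density);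
* the finite-size coefficient tends to `3/2` (`ChatterjeeFreeEnergy.tendsto_coeff`);
* `ChatterjeeFreeEnergy.tendsto_of_tendsto_prod_atTop` passes from the joint limit to `β → ∞`;
* the crux's dimension is `finrank(repLieAlgebra r) = D` (`finrank_span_eq_finrank_repLieAlgebra`).

This is the `r(G) ≤ U(N)` version of the tree's `U(N)` reduction `chatterjee_freeEnergyDensity_of`
(`LatticeGaugeAsymptoticsFreeEnergyProofs`). No definitions, no named facts.
-/

noncomputable section

open scoped Matrix.Norms.Frobenius ENNReal NNReal
open MeasureTheory Measure Filter Topology Set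
open Literature.Probability.LatticeModels Literature.MathematicalPhysics.QuantumLattice
open Literature.MathematicalPhysics.QuantumFieldTheory

namespace Summit.QuantumFields.YangMills.Theorems.FreeEnergyLogCoefficient

/-- **Transfer from the joint cube limit to the torus free energy of the crux (`d = 4`,
coefficient `3D/2`).** If `F(B_n, β) + ½(3 − 4/n + n^{-4}) D log β → K₀` jointly in `(n, β)`, then
`f_r(β) + (3/2)·finrank(span{X | ∀t, exp(tX) ∈ range r.ρ})·log β → K₀` as `β → ∞`: at fixed `β`
the free-boundary cube free energies converge to the torus free energy density
(`ChatterjeeFreeEnergy.tendsto_freeEnergyPerSite_halfOpenBox`, any compact second-countable `G` —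
here `G ≅ r(G)` is a closed subgroup of `M_N(ℂ)`), the coefficient tends to `3/2`
(`ChatterjeeFreeEnergy.tendsto_coeff`), `ChatterjeeFreeEnergy.tendsto_of_tendsto_prod_atTop` passes
to `β → ∞`, and `finrank(span …) = finrank(repLieAlgebra r) = D`
(`finrank_span_eq_finrank_repLieAlgebra`). [cite: arXiv160201222, Thm. 2.1, §17] -/
theorem stub_transfer {G : Type} [Group G] [TopologicalSpace G] [IsTopologicalGroup G]
    [CompactSpace G] [MeasurableSpace G] [BorelSpace G] (r : LatticeRep G) {D : ℕ}
    (hD : D = Module.finrank ℝ ↥(repLieAlgebra r)) {K₀ : ℝ}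
    (h : Tendsto (fun p : ℕ × ℝ => freeEnergyPerSite r.ρ p.2 (halfOpenBox 4 p.1) +
        (1 / 2) * ((4 : ℝ) - 1 - 4 / p.1 + 1 / (p.1 : ℝ) ^ 4) * (D : ℝ) * Real.log p.2)
      (atTop ×ˢ atTop) (𝓝 K₀)) :
    ∃ K : ℝ, Tendsto (fun β : ℝ => freeEnergyDensity 4 r.ρ β +
        (3 * (Module.finrank ℝ ↥(Submodule.span ℝ {X : Matrix (Fin r.N) (Fin r.N) ℂ |
          ∀ t : ℝ, NormedSpace.exp ((t : ℂ) • X) ∈ Set.range r.ρ}) : ℝ) / 2) * Real.log β)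
      atTop (𝓝 K) := by
  -- `G ≅ r(G) ⊆ M_N(ℂ)` is second countable (the `Matrix` synonym hides the `Pi` instance)
  haveI : SecondCountableTopology (Matrix (Fin r.N) (Fin r.N) ℂ) :=
    inferInstanceAs (SecondCountableTopology (Fin r.N → Fin r.N → ℂ))
  haveI : SecondCountableTopology G :=
    (r.continuous.isClosedEmbedding r.injective).isEmbedding.secondCountableTopology
  -- the crux's dimension is `D`
  rw [finrank_span_eq_finrank_repLieAlgebra r, ← hD]
  refine ⟨K₀, ChatterjeeFreeEnergy.tendsto_of_tendsto_prod_atTop h fun β => ?_⟩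
  -- at fixed `β`: the cube free energies converge to the torus density, the coefficient to `3/2`
  have h1 := ChatterjeeFreeEnergy.tendsto_freeEnergyPerSite_halfOpenBox (d := 4) r.ρ r.continuous β
  have h2 := ChatterjeeFreeEnergy.tendsto_coeff (m := 4) (by norm_num) (1 / 2 : ℝ)
    ((D : ℝ) * Real.log β)
  have h3 := h1.add h2
  have hlim : freeEnergyDensity 4 r.ρ β + (1 / 2 : ℝ) * (((4 : ℕ) : ℝ) - 1) * ((D : ℝ) * Real.log β) =
      freeEnergyDensity 4 r.ρ β + 3 * (D : ℝ) / 2 * Real.log β := by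
    push_cast
    ring
  rw [hlim] at h3
  refine h3.congr fun n => ?_
  push_cast
  ring

end Summit.QuantumFields.YangMills.Theorems.FreeEnergyLogCoefficient

end
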